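import Summits.BirchSwinnertonDyer.BirchSwinnertonDyer.Theorems.ManinLocalTwoThreeHeckeAdCommute
import HarnessLib

/-!
# `T_r` commutes with `Ad(U⁻(x))` on `Hom(Γ₀(2x), R)` for even `x` and odd `r` (σ2 (a1) of MEMO-es §25.6)

Summit `BirchSwinnertonDyer`, route `ManinLocalTwoThree` (cell bsd-f2-manin), crux C2 `ManinOddAtFour` (stmt-BirchSwinnertonDyer-22967),
line `kato_shift_two` v6, stub 3 (`C₃`-image residual), descent step E-es-37 of MEMO-es §25: at level `N = 2^j L′` (`j ≥ 2`,
`L′` odd) the lower unipotent `U = U⁻(2^{j−1}L′) = (1 0; 2^{j−1}L′ 1)` normalises `Γ₀(N)` and the auxiliary cocycle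
`u ∘ Ad(U) − u` must be a generalised Hecke eigenvector (cell INBOX 2026-08-28T04:15:22Z, es (a1)).  Here, for `U ∈ SL₂(ℤ)`
with matrix `(1 0; x 1)`, `x` EVEN and `N = 2x`: `γ ∈ Γ₀(N) ⟺ UγU⁻¹ ∈ Γ₀(N)` (`mem_Gamma0_iff_lowerUnip_conj`) and
`U βᵢ U⁻¹ ∈ Δ₀ᴺ(r)` for every Hecke representative at an ODD prime `r` (`lowerUnip_conj_heckeRep_mem_delta0`), hence
(`heckeU_zero_lowerUnip_conj`, from `heckeU_zero_conj`) `(T_r (u ∘ Ad U))(γ) = (T_r u)(UγU⁻¹)` for every degree-`0` cocycle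
`u`.  No new definitions; nothing about BSD or Manin's conjecture is proved here.

References: G. Shimura (1971) §8.3 [cite: Shimura1971, §8.3 (8.3.2)]; cell memo HOME/MEMO-es.md §25.3 (i), §25.6 σ2.
-/

set_option autoImplicit false
set_option linter.dupNamespace false

open scoped MatrixGroups

open CongruenceSubgroup Matrix.SpecialLinearGroup Literature.NumberTheory.EllipticCurves.ModularForms
  Literature.NumberTheory.EllipticCurves.ModularForms.HidaCohomology

namespace Summit.BirchSwinnertonDyer.BirchSwinnertonDyer.Theorems.ManinLocalTwoThree

section LowerUnip

variable {x : ℤ} {U : SL(2, ℤ)} (hU : (U : Matrix (Fin 2) (Fin 2) ℤ) = !![1, 0; x, 1])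
include hU

/-- **Conjugation by `U = (1 0; x 1)` on integer matrices**: `U M U⁻¹ = (m₀₀ − x m₀₁, m₀₁; m₁₀ + x(m₀₀ − m₁₁) − x² m₀₁, m₁₁ + x m₀₁)`.
[folklore] -/
theorem lowerUnip_conj_eq (M : Matrix (Fin 2) (Fin 2) ℤ) :
    (U : Matrix (Fin 2) (Fin 2) ℤ) * M * ((U⁻¹ : SL(2, ℤ)) : Matrix (Fin 2) (Fin 2) ℤ) =
      !![M 0 0 - x * M 0 1, M 0 1; M 1 0 + x * (M 0 0 - M 1 1) - x ^ 2 * M 0 1, M 1 1 + x * M 0 1] := by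
  rw [Matrix.SpecialLinearGroup.coe_inv, hU, Matrix.adjugate_fin_two]
  ext i j
  fin_cases i <;> fin_cases j <;>
    simp [Matrix.mul_apply, Fin.sum_univ_two, Matrix.vecMul, dotProduct] <;> ring

omit hU in
/-- Parity from a determinant: `a d − b c = 1` with `c` even forces `a` and `d` odd. [folklore] -/
theorem odd_of_det_of_even {a b c d : ℤ} (hdet : a * d - b * c = 1) (hc : (2 : ℤ) ∣ c) : Odd a ∧ Odd d := by
  obtain ⟨m, hm⟩ := hc
  have h : Odd (a * d) := ⟨b * m, by linear_combination hdet + b * hm⟩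
  exact Int.odd_mul.mp h

omit hU in
/-- The correction term: for `x` even and `a, d` odd, `2x ∣ x (a − d) − x² b`. [folklore] -/
theorem two_mul_dvd_corr {a b d : ℤ} (hx : (2 : ℤ) ∣ x) (ha : Odd a) (hd : Odd d) :
    2 * x ∣ x * (a - d) - x ^ 2 * b := by
  obtain ⟨y, hy⟩ := hx
  obtain ⟨k, hk⟩ := Odd.sub_odd ha hd
  exact ⟨k - y * b, by rw [hk, hy]; ring⟩

/-- **`U = (1 0; x 1)` normalises `Γ₀(2x)` for even `x`**: `γ ∈ Γ₀(N) ⟺ U γ U⁻¹ ∈ Γ₀(N)` when `N = 2x`, `2 ∣ x`.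
[cite: Shimura1971, §8.3 (8.3.2)] -/
theorem mem_Gamma0_iff_lowerUnip_conj {N : ℕ} (hN : (N : ℤ) = 2 * x) (hx : (2 : ℤ) ∣ x) (γ : SL(2, ℤ)) :
    γ ∈ Gamma0 N ↔ U * γ * U⁻¹ ∈ Gamma0 N := by
  have hdet := det_entries γ
  have hconj : (U * γ * U⁻¹ : SL(2, ℤ)) 1 0 = γ 1 0 + x * (γ 0 0 - γ 1 1) - x ^ 2 * γ 0 1 := by
    have h := lowerUnip_conj_eq hU (γ : Matrix (Fin 2) (Fin 2) ℤ)
    rw [← Matrix.SpecialLinearGroup.coe_mul, ← Matrix.SpecialLinearGroup.coe_mul] at h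
    rw [h]
    rfl
  rw [Gamma0_mem, Gamma0_mem, hconj, ZMod.intCast_zmod_eq_zero_iff_dvd, ZMod.intCast_zmod_eq_zero_iff_dvd, hN]
  have h2N : (2 : ℤ) ∣ 2 * x := dvd_mul_right 2 x
  constructor
  · intro hc
    obtain ⟨ha, hd⟩ := odd_of_det_of_even hdet (h2N.trans hc)
    have h := two_mul_dvd_corr (b := γ 0 1) hx ha hd
    have h' := dvd_add hc h
    rwa [add_sub] at h'
  · intro hc'
    have hdet' : (γ 0 0 - x * γ 0 1) * (γ 1 1 + x * γ 0 1) - γ 0 1 * (γ 1 0 + x * (γ 0 0 - γ 1 1) - x ^ 2 * γ 0 1) = 1 := by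
      linear_combination hdet
    obtain ⟨ha', hd'⟩ := odd_of_det_of_even hdet' (h2N.trans hc')
    obtain ⟨y, hy⟩ := hx
    have hev : Even (x * γ 0 1) := ⟨y * γ 0 1, by rw [hy]; ring⟩
    have ha : Odd (γ 0 0) := by
      have h := ha'.add_even hev
      rwa [sub_add_cancel] at h
    have hd : Odd (γ 1 1) := by
      have h := hd'.sub_even hev
      rwa [add_sub_cancel_right] at h
    have h := two_mul_dvd_corr (b := γ 0 1) ⟨y, hy⟩ ha hd
    have h' := dvd_sub hc' h
    rwa [add_sub_assoc, add_sub_cancel_right] at h'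

/-- **`U βᵢ U⁻¹ ∈ Δ₀ᴺ(r)`** for every Hecke representative `βᵢ` at an odd prime `r` (`N = 2x`, `x` even):
`U (1 j; 0 r) U⁻¹ = (1 − xj, j; x(1 − r) − x²j, r + xj)` and `U diag(r,1) U⁻¹ = (r, 0; x(r − 1), 1)`. [cite: Shimura1971, §8.3 (8.3.2)] -/
theorem lowerUnip_conj_heckeRep_mem_delta0 {N : ℕ} (hN : (N : ℤ) = 2 * x) (hx : (2 : ℤ) ∣ x) {r : ℕ}
    (hr : r.Prime) (hr2 : r ≠ 2) (i : HeckeIdx N r) :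
    (U : Matrix (Fin 2) (Fin 2) ℤ) * heckeRep r i.1 * ((U⁻¹ : SL(2, ℤ)) : Matrix (Fin 2) (Fin 2) ℤ) ∈ Delta0 N (r * 1) := by
  obtain ⟨y, hy⟩ := hx
  have hrodd : Odd (r : ℤ) := by exact_mod_cast hr.odd_of_ne_two hr2
  obtain ⟨s, hs⟩ := hrodd
  rw [lowerUnip_conj_eq hU, mul_one]
  obtain ⟨_ | j, hi⟩ := i
  · have hrN : ¬ r ∣ N := hi rfl
    refine ⟨?_, ?_, ?_⟩
    · rw [Matrix.det_fin_two_of]; simp [heckeRep]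
    · show (N : ℤ) ∣ _
      simp only [heckeRep, Matrix.of_apply, Matrix.cons_val', Matrix.cons_val_zero, Matrix.cons_val_one,
        Matrix.empty_val', Matrix.cons_val_fin_one]
      rw [hN, hy, hs]
      exact ⟨s, by ring⟩
    · show IsCoprime _ (N : ℤ)
      simp only [heckeRep, Matrix.of_apply, Matrix.cons_val', Matrix.cons_val_zero, Matrix.cons_val_one,
        Matrix.empty_val', Matrix.cons_val_fin_one, mul_zero, sub_zero]
      exact Nat.isCoprime_iff_coprime.mpr ((Nat.Prime.coprime_iff_not_dvd hr).mpr hrN)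
  · refine ⟨?_, ?_, ?_⟩
    · rw [Matrix.det_fin_two_of]; simp [heckeRep]; ring
    · show (N : ℤ) ∣ _
      simp only [heckeRep, Matrix.of_apply, Matrix.cons_val', Matrix.cons_val_zero, Matrix.cons_val_one,
        Matrix.empty_val', Matrix.cons_val_fin_one]
      rw [hN, hy, hs]
      exact ⟨-s - (j.val : ℤ) * y, by ring⟩
    · show IsCoprime _ (N : ℤ)
      simp only [heckeRep, Matrix.of_apply, Matrix.cons_val', Matrix.cons_val_zero, Matrix.cons_val_one,
        Matrix.empty_val', Matrix.cons_val_fin_one]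
      rw [hN, hy]
      have h1 : IsCoprime (1 - 2 * y * (j.val : ℤ)) 2 := ⟨1, y * (j.val : ℤ), by ring⟩
      have h2 : IsCoprime (1 - 2 * y * (j.val : ℤ)) (2 * y) := ⟨1, (j.val : ℤ), by ring⟩
      exact h1.mul_right h2

/-- **σ2 (a1): `T_r` commutes with `Ad(U)` on `Hom(Γ₀(2x), R)`** (`U = (1 0; x 1)`, `x` even, `r` an odd prime): for a
degree-`0` cocycle `u` and `γ ∈ Γ₀(N)`, `N = 2x`, `(T_r (δ ↦ u(U δ U⁻¹)))(γ) = (T_r u)(U γ U⁻¹)`. [cite: Shimura1971, §8.3 (8.3.2)] -/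
theorem heckeU_zero_lowerUnip_conj {N : ℕ} (hN : (N : ℤ) = 2 * x) (hx : (2 : ℤ) ∣ x) {r : ℕ} [NeZero r]
    (hr : r.Prime) (hr2 : r ≠ 2) {R : Type*} [CommRing R] {u : Gamma0 N → Fin 1 → R} (hu : u ∈ cocycles 0 N R)
    (γ : Gamma0 N) :
    heckeU 0 N R hr (fun δ ↦ u ⟨U * (δ : SL(2, ℤ)) * U⁻¹, (mem_Gamma0_iff_lowerUnip_conj hU hN hx δ).mp δ.2⟩) γ =
      heckeU 0 N R hr u ⟨U * (γ : SL(2, ℤ)) * U⁻¹, (mem_Gamma0_iff_lowerUnip_conj hU hN hx γ).mp γ.2⟩ :=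
  heckeU_zero_conj hr (mem_Gamma0_iff_lowerUnip_conj hU hN hx) (lowerUnip_conj_heckeRep_mem_delta0 hU hN hx hr hr2) hu γ

end LowerUnip

end Summit.BirchSwinnertonDyer.BirchSwinnertonDyer.Theorems.ManinLocalTwoThree
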